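import Summits.QuantumFields.YangMills.Theorems.UnitScaleTiltHistoryTailLaneTailV4ChiDisplays
import Summits.QuantumFields.YangMills.Theses.UnitScaleTilt
import HarnessLib

/-!
# `Lines/birth_v6b.lean` — CANDIDATE v6-b display for crux `HistoryTailL` (stmt-QuantumFields-19936) — ideator ym-r3-idea-2 g17 under ★★OWNER WORD 83 (3) «RECORD-UNBUNDLING»;
# PUBLISHED AS AN ORGAN-LEVEL LINE (RULING №36 (3)) — NOT REGISTERED.  The skeleton of record stays `Lines/birth_v5p10.lean` 6695f49b (v5-χ, ONE row `stub_laneRecordsV4Chi`, verb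
# 2026-08-30T02:47:27Z) until the OWNER words otherwise.

WHAT THIS FILE SHOWS (kernel-checked, sorries ONLY in the two stubs).  The ONE displayed row of v5-χ, `∀ L, Odd L → 1 < L → AlphaInputsT3ACv4RecChi L`, UNBUNDLES — with glue
ALREADY LANDED (w3 g20 census `RECORD-UNBUNDLING-CENSUS-w3g20.md` d30d44609e4a111c, evidence #48; ✓`HistoryTailSelSupplier.pinnedPartsT3ACRecSelXsV4Chi_of_thm1_rows`
`Theorems/AlphaInputsT3ACv4RecordSelXs.lean` :318, ✓`HistoryTailLaneTailV4Chi.historyTailL_of_pinnedPartsRecSelXsV4Chi` `…LaneTailV4ChiDisplays.lean` :48) — into TWO content rows: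
* `stub_thm1T` — (T) [Balaban1985Variational] Thm 1 in the global reading at SOME box per odd block size: `∃ a₀ a₁ B₃ > 0, Thm1GlobalMinAt L a₀ a₁ B₃`.  This is the (T8) binder of the
  L-R4 door ✓`historyTailL_of_thm1In8_selXsV4DataRows_allL` with the conjunct `MinimisersIn8At L a₀ a₁ B₃` DROPPED — both landed closers discard it (`obtain ⟨…, hT, -⟩ := hT8 …`,
  `…v4RecordSelXs.lean` :391, `…v4SeamWindowDL.lean` :160), so for 19936 the (T)-only text is the honest row (the (T8) text is 19200∕20520's sharing currency; swapping it back in is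
  a one-binder edit if the OWNER wants ONE shared item).  Supplier: the 19200 `MinimiserStabilityRegPr` lineage (✓`MinimiserPin.thm1GlobalMinAt_of_attained_of_in8`,
  ✓`T3PrintedMinimiserExistence.thm1GlobalMinAt_of_minimalIn8`).  OPEN.
* `stub_nodeOSelXs` — (O‴χₛ)+record rows on the supplier's box: the `hrows` binder of the same door VERBATIM (a floor `B₀`, a box `(0, A₀] × (0, A₁]`; per `(B, a₀, a₁)` in range with
  (T) at that box: thresholds `(b₁, p₁)`, per profile a constants record with exact profile and `B₃ = B`, three `C68`∕profile size rows, and per [7]-family the seam row (71)_sym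
  `SmallFactor71OfRecT3` at every `(γ, K)` and (O‴χₛ) «if some pinned minimiser selection satisfies `TrivMinimiserRowsT3`, one does that ALSO carries NODE O's Sect. B–C χ-data
  `DataRowsT3XsChiSel`»).  Its size∕collar∕`γ₀` rows are ✓discharged constants bookkeeping (`pinnedPartsT3ACRecSelXsV4Chi_shell`, `smallFactor71OfRecT3_of_gamma0_dL`); its CONTENT is
  NODE O d = 3 (BILL §3 B0–B4).  OPEN, multi-seat.
INDEPENDENCE (BC7-class, by inspection — batteries not run on this import cone): `stub_thm1T` says nothing about the expansion data (cannot give `HistoryTailL`); `stub_nodeOSelXs` is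
guarded by `Thm1GlobalMinAt L a₀ a₁ B →` and by the `TrivMinimiserRowsT3` antecedent, so without (T) it is served vacuously — neither row alone is the crux; together they give it by the
5-line composition below.  RULING №38: both rows carry `Odd L → 1 < L`; `Thm1GlobalMinAt` ∕ `DataRowsT3XsChiSel` are hypothesis schemas over printed facts, not refutable from tree facts
known to me (negatives index read 08-29).  RULING №39: exactly ONE theorem below concludes the crux decl by name, zero extra hypotheses.
HONEST: a DISPLAY candidate; nothing of (T), NODE O, 19936, 19200, 20520 or R3 is proved here; R3 = SU(2) YM₃ on T³ — NOT d = 4, NOT infinite volume, NOT a mass gap, NOT Clay.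
[cite: Balaban1985UV3, (5) p.256, (47) p.267, (67)–(71) p.273 and Thm 2 p.272; Balaban1985Variational, Thm 1 (6)–(8) pp.278–279]
-/

set_option autoImplicit false

open Literature.MathematicalPhysics.QuantumFieldTheory.Balaban1983to89
open Literature.MathematicalPhysics.QuantumFieldTheory.Balaban1983to89.T3ContinuumYM3Torus
open Literature.MathematicalPhysics.QuantumFieldTheory.Balaban1983to89.T3PrintedMinimiserExistence (Thm1GlobalMinAt)
open Literature.MathematicalPhysics.QuantumFieldTheory.Balaban1983to89.ExpMeanLog (deltaSU)
open Literature.MathematicalPhysics.QuantumFieldTheory.Balaban1985CMP102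
open Literature.MathematicalPhysics.QuantumFieldTheory.Balaban1985CMP102.Setting
open Summit.QuantumFields.Balaban3D.Carriers
open Summit.QuantumFields.Balaban3D.Proofs.Primitives
open Summit.QuantumFields.Balaban3D.Proofs.Thresholds (Q0)
open Summit.QuantumFields.YangMills.Theorems
open B7Prop2Explicit (C0)

namespace Summit.QuantumFields.YangMills.Cruxes.HistoryTailL.BirthV6b

/-! ## §1 The two candidate rows (the ONLY sorries) -/

/-- ROW (T) — [Balaban1985Variational] Thm 1, global reading, at some box per odd block size `L > 1` (supplier: the 19200 lineage). [cite: Balaban1985Variational, Thm 1 (6)–(8) pp.278–279] -/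
theorem stub_thm1T : ∀ L : ℕ, Odd L → 1 < L → ∃ a₀ a₁ B₃ : ℝ, 0 < a₀ ∧ 0 < a₁ ∧ 0 < B₃ ∧ Thm1GlobalMinAt L a₀ a₁ B₃ := by
  sorry

/-- ROW (O‴χₛ)+record rows — the `hrows` binder of ✓`historyTailL_of_thm1In8_selXsV4DataRows_allL` VERBATIM (NODE O d = 3's χ-data for one pinned minimiser selection per record
of the supplier's box, with the record's size rows and the seam row (71)_sym). [cite: Balaban1985UV3, (47) p.267, (67)–(71) p.273 and Thm 2 p.272] -/
theorem stub_nodeOSelXs : ∀ L : ℕ, Odd L → 1 < L → ∃ (B₀ A₀ A₁ : ℝ), 0 < A₀ ∧ 0 < A₁ ∧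
  ∀ (B a₀ a₁ : ℝ), B₀ ≤ B → 1 ≤ 2 * B → 0 < a₀ → a₀ ≤ A₀ → 0 < a₁ → a₁ ≤ A₁ → B * a₁ ≤ a₀ →
    (143 * ((((3 + 4 : ℕ) : ℝ)) ^ 2 / 4) ^ 2) * (2 * (B * a₁)) ≤ 1 / 3 →
    2 * (2 * (B * a₁)) ≤ 2 * deltaSU (Fin 2) / (((3 + 4) * L : ℕ) : ℝ) ^ 2 →
    Thm1GlobalMinAt L a₀ a₁ B →
    ∃ (b₁ p₁ : ℝ), ∀ (b₀ p₀ : ℝ), b₁ ≤ b₀ → p₁ ≤ p₀ →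
      ∃ 𝔠 : AlphaConsts L (suGroupModel 2).N, 𝔠.b₀ = b₀ ∧ 𝔠.p₀ = p₀ ∧ 𝔠.B₃ = B ∧
        4 * 𝔠.B₃ * (L : ℝ) ^ 2 * avgWindowFactor L ≤ 𝔠.C68 ∧
        Real.exp (𝔠.p₀ - 1) ≤ 3 * C0 3 * 𝔠.C68 * (𝔠.b₀ * Q0 𝔠.p₀) ∧
        (𝔠.b₀ * Q0 𝔠.p₀) * (2 * (L : ℝ) ^ 2 * avgWindowFactor L) ^ 2 ≤ 3 * C0 3 * 𝔠.C68 * a₁ ^ 2 ∧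
        ∀ (F : T3Family) (hF : F.L = L),
          (∀ (γ : ℝ) (hγ : 0 < γ) (hγ1 : γ ≤ (min (hF ▸ 𝔠).gamma0 1) ^ 2) (K : ℕ),
            AlphaInputsT3AC.SmallFactor71OfRecT3 F (hF ▸ 𝔠) γ hγ hγ1 K) ∧
          ∀ (γ : ℝ) (hγ : 0 < γ) (hγ1 : γ ≤ (min (hF ▸ 𝔠).gamma0 1) ^ 2) (K : ℕ),
            (∃ Ut : (k : ℕ) → GaugeField (F.P K) k (Matrix.specialUnitaryGroup (Fin 2) ℂ) →
                GaugeField (F.P K) 0 (Matrix.specialUnitaryGroup (Fin 2) ℂ),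
              AlphaInputsT3AC.TrivMinimiserRowsT3 F (hF ▸ 𝔠) γ hγ hγ1 a₀ a₁ K Ut) →
            ∃ Ut : (k : ℕ) → GaugeField (F.P K) k (Matrix.specialUnitaryGroup (Fin 2) ℂ) →
                GaugeField (F.P K) 0 (Matrix.specialUnitaryGroup (Fin 2) ℂ),
              AlphaInputsT3AC.TrivMinimiserRowsT3 F (hF ▸ 𝔠) γ hγ hγ1 a₀ a₁ K Ut ∧
                AlphaInputsT3AC.DataRowsT3XsChiSel F (hF ▸ 𝔠) γ hγ hγ1 K Ut := by
  sorry

/-! ## §2 The crux BY NAME — no sorry below this line -/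

/-- **`HistoryTailL ⇐ stub_thm1T ∧ stub_nodeOSelXs`** through the landed Sel∕Xs display knit and the v4 χ-door — item stmt-QuantumFields-19936 BY NAME. -/
theorem HistoryTailL_of : Summit.QuantumFields.YangMills.Theses.UnitScaleTilt.HistoryTailL :=
  HistoryTailLaneTailV4Chi.historyTailL_of_pinnedPartsRecSelXsV4Chi fun L hLo hL => by
    obtain ⟨B₀, A₀, A₁, hA₀, hA₁, h⟩ := stub_nodeOSelXs L hLo hL
    exact HistoryTailSelSupplier.pinnedPartsT3ACRecSelXsV4Chi_of_thm1_rows hL (stub_thm1T L hLo hL) hA₀ hA₁ h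

end Summit.QuantumFields.YangMills.Cruxes.HistoryTailL.BirthV6b
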